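import Literature.AlgebraicGeometry.Surfaces.DiagonalFormsEmbedU3m
import Literature.AlgebraicGeometry.Surfaces.K3TranscendentalLatticeSignature
import Literature.AlgebraicGeometry.Surfaces.K3Marking
import HarnessLib

/-!
# K3 surfaces of Picard number `ρ ≥ 17`: the Kuga–Satake correspondence is algebraic and the Hodge conjecture holds
# for every power — from Floccari 2026 Thm. 5.11 and the signature of the transcendental lattice — PROVED modulo
# the cited facts, BY NAME

Family `hodge`, layer `Literature/AlgebraicGeometry/Surfaces`. Written for the cell `hodge-nonav` (planner note
NOTE-KSHC-rank17 r4, THEOREM A; planner sketch `RankSeventeenSketch.lean` r3 — whose orthogonal-coordinates layer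
is re-proved here over the tree names — with its two non-print inputs now in the tree: W1 =
`DiagonalFormsEmbedU3m` (PROVED) and W2 = the signature fact `Huybrechts2016_K3_transcendentalLattice_signature`).
THEOREMS ONLY (one auxiliary `def` with a body, `k3OrthCoords`; no named fact, no instance; D-0026 net debt `0`).

THE RESULT. Floccari (Geom. Topol. 30 (2026), Thm. 5.11; tree facts
`Floccari2026_kugaSatakeCorrespondence_algebraic_of_K3_of_transcendental_embedding` (i) and
`Floccari2026_hodgeClasses_algebraic_powers_of_K3_of_transcendental_embedding` (ii)): if the rational transcendental
lattice `T(S)_ℚ` of a projective K3 surface `S` embeds isometrically into `(U^{⊕3} ⊕ ⟨−m⟩)_ℚ` for some `m > 0`, then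
the Kuga–Satake correspondence of `S` is algebraic and all Hodge classes on all powers `Sᵏ` are algebraic. For
`ρ(S) ≥ 17`, i.e. `rank T(S) = 22 − ρ(S) ≤ 5`, the hypothesis ALWAYS holds: `T(S)_ℚ` is a non-degenerate quadratic
space of signature `(2, 20 − ρ)` (Huybrechts, *Lectures on K3 Surfaces*, Ch. 1 Prop. 2.4 + Ch. 3 Lemma 3.1; tree fact
`Huybrechts2016_K3_transcendentalLattice_signature`), and every rational quadratic space of rank `r ≤ 5` and signature
`(2, r − 2)` embeds isometrically into `(U^{⊕3} ⊕ ⟨−m⟩)_ℚ` for a suitable `m` (classification of rational forms,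
Serre Ch. IV §3.3; tree theorem `diagEmbedsU3m`). Hence: **for every complex projective K3 surface with
`ρ(S) ≥ 17` the Kuga–Satake correspondence is algebraic and the Hodge conjecture holds for all powers `Sᵏ`** — no
case distinction on `ρ ∈ {17, …, 20}` and no abelian-type / Kummer hypothesis (Morrison) is used. (For `ρ = 20, 19`
and Kummer-type cases this is classical — Shioda–Inose, Morrison 1985; for `ρ = 17, 18` in this generality it is
read off Floccari 2026 as here.)

WHAT IS PROVED (all modulo the facts passed BY NAME as hypotheses `hF₁`, `hF₂`, `hSig`, `hmark`).
* `k3OrthCoords c w` and §1 — orthogonal coordinates w.r.t. an orthogonal family `c` of `ℚ²²` with non-zero weights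
  `w` for `k3FormRat`: `v = Σ (coordᵢ v) cᵢ` on `span c`, and `(v.u) = Σ wᵢ coordᵢ(v) coordᵢ(u)` there.
* `exists_transcendental_u3m_embedding_of_orthogonal_family` — from an orthogonal family with `r ≤ 5` members and
  K3-type weights spanning the transcendental coordinates: `∃ m > 0, ∃ ι : ℚ²² →ₗ ℚ⁷` isometric and injective on
  the transcendental vectors (EXACTLY the binders of Floccari's facts), via `diagEmbedsU3m`.
* `exists_transcendental_u3m_embedding_of_finrank_le_five` — the same from `dim_ℚ T(S)_ℚ ≤ 5` and the signature fact.
* **`IsK3Surface.isKSCorrespondenceAlgebraicBetti_of_finrank_transcendentalCoords_le_five`**,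
  **`IsK3Surface.hodgeConjectureFor_pow_of_finrank_transcendentalCoords_le_five`** — THEOREM A in a marking `(η, p)`.
* **`IsK3Surface.isKSCorrespondenceAlgebraicBetti_of_finrank_transcendental_le_five`**,
  **`IsK3Surface.hodgeConjectureFor_pow_of_finrank_transcendental_le_five`** — THEOREM A marking-free: hypotheses
  `IsK3Surface S` and `dim_ℂ (T(S) ⊗ ℂ) ≤ 5` (`transcendentalSubspace S = NS(S)^⊥ ⊗ ℂ`), the marking supplied by
  the tree fact `Huybrechts_K3_marking_exists`.

## References
* [Floccari2026] S. Floccari, Geom. Topol. 30 (2026) — Thm. 5.11 (i), (ii), Lemma 5.5, §5.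
* [Huybrechts2016K3] D. Huybrechts, *Lectures on K3 Surfaces* — Ch. 1 Prop. 2.4 (p. 19), Prop. 3.5 (p. 24); Ch. 3
  Lemma 3.1 (p. 62); Ch. 4 §4 (Kuga–Satake); Ch. 14 Cor. 3.5 (p. 348).
* [Serre1973] J.-P. Serre, *A Course in Arithmetic* — Ch. IV §3.3 Thm. 9 (via `diagEmbedsU3m`).
* [Morrison1985KS] D. Morrison, in *Arithmetic and Geometry* — the abelian-type cases (context only).

## Provenance
Cell `hodge-nonav` (summit `HodgeConjecture`, rung F-H1), planner note NOTE-KSHC-rank17 (P3 g28/g29) and sketch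
`RankSeventeenSketch.lean` r3 (sha16 7a6df8b5e8668af6); seat `littype-FH1-2` (literature-prover, generation 17).
-/

noncomputable section

open Literature.AlgebraicTopology.SingularHomology

namespace Literature.AlgebraicGeometry.Surfaces

/-! ### §1 Orthogonal coordinates on the span of an orthogonal family of `ℚ²²` -/

/-- Orthogonal-projection coordinates with respect to an orthogonal family `c` of `ℚ²²` with weights `w`
(`coordᵢ v = (cᵢ.v)/wᵢ` for the rational K3 form `k3FormRat`). [cite: Huybrechts2016K3, Ch. 3 Lemma 3.1 (p. 62)]
[cite: Floccari2026, Lemma 5.5 (§5)] -/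
def k3OrthCoords {r : ℕ} (c : Fin r → (K3Index → ℚ)) (w : Fin r → ℚ) : (K3Index → ℚ) →ₗ[ℚ] (Fin r → ℚ) :=
  LinearMap.pi fun i => (w i)⁻¹ • k3FormRat (c i)

/-- The `i`-th orthogonal coordinate. [cite: Huybrechts2016K3, Ch. 3 Lemma 3.1 (p. 62)] -/
theorem k3OrthCoords_apply {r : ℕ} (c : Fin r → (K3Index → ℚ)) (w : Fin r → ℚ) (v : K3Index → ℚ) (i : Fin r) :
    k3OrthCoords c w v i = (w i)⁻¹ * k3FormRat (c i) v := by
  simp [k3OrthCoords]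

/-- Pairing a combination of an orthogonal family against `c j` picks out the `j`-th coefficient times `w j`.
[cite: Huybrechts2016K3, Ch. 3 Lemma 3.1 (p. 62)] -/
theorem k3FormRat_apply_sum_smul_of_gram {r : ℕ} (c : Fin r → (K3Index → ℚ)) (w : Fin r → ℚ)
    (hgram : ∀ i j, k3FormRat (c i) (c j) = if i = j then w i else 0) (a : Fin r → ℚ) (j : Fin r) :
    k3FormRat (c j) (∑ i, a i • c i) = a j * w j := by
  rw [map_sum]
  simp_rw [map_smul, smul_eq_mul, hgram]
  simp [mul_comm]

/-- A vector of the span of an orthogonal family with non-zero weights is the combination of the family with its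
orthogonal coordinates. [cite: Huybrechts2016K3, Ch. 3 Lemma 3.1 (p. 62)] -/
theorem eq_sum_k3OrthCoords_smul {r : ℕ} (c : Fin r → (K3Index → ℚ)) (w : Fin r → ℚ) (hw : ∀ i, w i ≠ 0)
    (hgram : ∀ i j, k3FormRat (c i) (c j) = if i = j then w i else 0)
    {v : K3Index → ℚ} (hv : v ∈ Submodule.span ℚ (Set.range c)) :
    v = ∑ i, k3OrthCoords c w v i • c i := by
  obtain ⟨a, rfl⟩ := (Submodule.mem_span_range_iff_exists_fun ℚ).mp hv
  have hcoef : ∀ i, k3OrthCoords c w (∑ j, a j • c j) i = a i := by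
    intro i
    rw [k3OrthCoords_apply, k3FormRat_apply_sum_smul_of_gram c w hgram a i]
    field_simp [hw i]
  simp_rw [hcoef]

/-- **On the span of an orthogonal family the form is diagonal in the orthogonal coordinates**:
`(v.u) = Σ wᵢ · coordᵢ(v) · coordᵢ(u)`. [cite: Huybrechts2016K3, Ch. 3 Lemma 3.1 (p. 62)] [cite: Serre1973, Ch. IV §1.2] -/
theorem k3FormRat_eq_sum_mul_k3OrthCoords {r : ℕ} (c : Fin r → (K3Index → ℚ)) (w : Fin r → ℚ)
    (hw : ∀ i, w i ≠ 0) (hgram : ∀ i j, k3FormRat (c i) (c j) = if i = j then w i else 0)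
    {v u : K3Index → ℚ} (hv : v ∈ Submodule.span ℚ (Set.range c)) (hu : u ∈ Submodule.span ℚ (Set.range c)) :
    k3FormRat v u = ∑ i, w i * k3OrthCoords c w v i * k3OrthCoords c w u i := by
  set a := k3OrthCoords c w v with ha
  set b := k3OrthCoords c w u with hb
  have hv' := eq_sum_k3OrthCoords_smul c w hw hgram hv
  have hu' := eq_sum_k3OrthCoords_smul c w hw hgram hu
  rw [← ha] at hv'
  rw [← hb] at hu'
  rw [hv', hu', LinearMap.BilinForm.sum_left]
  simp_rw [LinearMap.BilinForm.smul_left, k3FormRat_apply_sum_smul_of_gram c w hgram b]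
  refine Finset.sum_congr rfl fun i _ => ?_
  ring

/-! ### §2 Floccari's embedding hypothesis from an orthogonal family with `r ≤ 5` members -/

/-- **Floccari's hypotheses from rank `≤ 5`.** Given, in a marking `η`, an orthogonal family `c` of `r ≤ 5` vectors
with K3-type weights `w` (two positive, the rest negative) spanning the transcendental rational coordinates,
there are `m > 0` and `ι : ℚ²² →ₗ ℚ⁷ = (U^{⊕3} ⊕ ⟨−m⟩)_ℚ` isometric and injective on the transcendental vectors —
exactly the binders of the tree's Floccari facts — by the tree theorem `diagEmbedsU3m` composed with the
orthogonal coordinates. [cite: Floccari2026, Thm. 5.11 and Lemma 5.5 (§5)] [cite: Serre1973, Ch. IV §3.3 Thm. 9] -/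
theorem exists_transcendental_u3m_embedding_of_orthogonal_family
    {S : Motives.SchemeOver ℂ} (η : HodgeTheory.complexBetti S (2 * 1) ≃ₗ[ℂ] (K3Index → ℂ))
    {r : ℕ} (hr : r ≤ 5) (c : Fin r → (K3Index → ℚ)) (w : Fin r → ℚ)
    (hspan : ∀ v, IsTranscendentalCoord S η v → v ∈ Submodule.span ℚ (Set.range c))
    (hgram : ∀ i j, k3FormRat (c i) (c j) = if i = j then w i else 0)
    (hw : ∀ i : Fin r, (i.val < 2 → 0 < w i) ∧ (2 ≤ i.val → w i < 0)) :
    ∃ m : ℕ, 0 < m ∧ ∃ ι : (K3Index → ℚ) →ₗ[ℚ] (U3mIndex → ℚ),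
      (∀ v u : K3Index → ℚ, IsTranscendentalCoord S η v → IsTranscendentalCoord S η u →
          u3mFormQ m (ι v) (ι u) = k3FormRat v u) ∧
      (∀ v : K3Index → ℚ, IsTranscendentalCoord S η v → ι v = 0 → v = 0) := by
  have hw0 : ∀ i, w i ≠ 0 := fun i => by
    rcases Nat.lt_or_ge i.val 2 with h | h
    · exact ((hw i).1 h).ne'
    · exact ((hw i).2 h).ne
  obtain ⟨m, hm, ι₀, hinj₀, hiso₀⟩ := diagEmbedsU3m r hr w hw
  refine ⟨m, hm, ι₀ ∘ₗ k3OrthCoords c w, ?_, ?_⟩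
  · intro v u hv hu
    rw [LinearMap.comp_apply, LinearMap.comp_apply, hiso₀,
      k3FormRat_eq_sum_mul_k3OrthCoords c w hw0 hgram (hspan v hv) (hspan u hu)]
  · intro v hv h0
    rw [LinearMap.comp_apply] at h0
    have h1 : k3OrthCoords c w v = 0 := hinj₀ (by rw [h0, map_zero])
    rw [eq_sum_k3OrthCoords_smul c w hw0 hgram (hspan v hv), h1]
    simp

/-- **Floccari's hypotheses from `dim_ℚ T(S)_ℚ ≤ 5` and the signature fact**: for a K3 surface with a Huybrechts
marking `(η, p)` and `dim_ℚ H²_tr(S, ℚ) ≤ 5` (`ρ(S) ≥ 17`), there are `m > 0` and `ι : ℚ²² →ₗ (U^{⊕3} ⊕ ⟨−m⟩)_ℚ`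
isometric and injective on the transcendental vectors. [cite: Floccari2026, Thm. 5.11 (§5)]
[cite: Huybrechts2016K3, Ch. 1 Prop. 2.4 (p. 19) and Ch. 3 Lemma 3.1 (p. 62)] -/
theorem exists_transcendental_u3m_embedding_of_finrank_le_five
    (hSig : Huybrechts2016_K3_transcendentalLattice_signature)
    {S : Motives.SchemeOver ℂ} (hS : IsK3Surface S)
    (η : HodgeTheory.complexBetti S (2 * 1) ≃ₗ[ℂ] (K3Index → ℂ)) (p : HodgeTheory.complexBetti S (2 * 2))
    (hp : p ≠ 0) (hpi : HodgeTheory.IsIntegralClass p)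
    (hgen : ∀ q : HodgeTheory.complexBetti S (2 * 2), HodgeTheory.IsIntegralClass q → ∃ n : ℤ, q = n • p)
    (hint : ∀ c : HodgeTheory.complexBetti S (2 * 1),
      HodgeTheory.IsIntegralClass c ↔ ∃ v : K3Index → ℤ, η c = fun i => (v i : ℂ))
    (hcup : ∀ a b : HodgeTheory.complexBetti S (2 * 1),
      cupProduct (rfl : 2 * 1 + 2 * 1 = 2 * 2) a b = k3Form (η a) (η b) • p)
    (hrank : Module.finrank ℚ ↥(transcendentalCoords S η) ≤ 5) :
    ∃ m : ℕ, 0 < m ∧ ∃ ι : (K3Index → ℚ) →ₗ[ℚ] (U3mIndex → ℚ),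
      (∀ v u : K3Index → ℚ, IsTranscendentalCoord S η v → IsTranscendentalCoord S η u →
          u3mFormQ m (ι v) (ι u) = k3FormRat v u) ∧
      (∀ v : K3Index → ℚ, IsTranscendentalCoord S η v → ι v = 0 → v = 0) := by
  obtain ⟨r, c, w, hr, hspan, hgram, hw⟩ := hSig.orthogonalBasis_package hS η p hp hpi hgen hint hcup
  exact exists_transcendental_u3m_embedding_of_orthogonal_family η (hr ▸ hrank) c w
    (fun v hv => (hspan v).1 hv) hgram hw

/-! ### §3 THEOREM A in a marking -/

/-- **K3 surfaces with `ρ ≥ 17`, Kuga–Satake half, in a marking**: for a K3 surface `S` with a Huybrechts marking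
`(η, p)` and `dim_ℚ H²_tr(S, ℚ) ≤ 5`, the Kuga–Satake correspondence of `S` is algebraic — Floccari 2026
Thm. 5.11 (i) BY NAME (`hF₁`), the signature fact BY NAME (`hSig`), and `diagEmbedsU3m`.
[cite: Floccari2026, Thm. 5.11 (i) (§5)] [cite: Huybrechts2016K3, Ch. 1 Prop. 2.4, Ch. 3 Lemma 3.1 and Ch. 4 §4] -/
theorem IsK3Surface.isKSCorrespondenceAlgebraicBetti_of_finrank_transcendentalCoords_le_five
    (hF₁ : Floccari2026_kugaSatakeCorrespondence_algebraic_of_K3_of_transcendental_embedding)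
    (hSig : Huybrechts2016_K3_transcendentalLattice_signature)
    {S : Motives.SchemeOver ℂ} (hS : IsK3Surface S)
    (η : HodgeTheory.complexBetti S (2 * 1) ≃ₗ[ℂ] (K3Index → ℂ)) (p : HodgeTheory.complexBetti S (2 * 2))
    (hp : p ≠ 0) (hpi : HodgeTheory.IsIntegralClass p)
    (hgen : ∀ q : HodgeTheory.complexBetti S (2 * 2), HodgeTheory.IsIntegralClass q → ∃ n : ℤ, q = n • p)
    (hint : ∀ c : HodgeTheory.complexBetti S (2 * 1),
      HodgeTheory.IsIntegralClass c ↔ ∃ v : K3Index → ℤ, η c = fun i => (v i : ℂ))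
    (hcup : ∀ a b : HodgeTheory.complexBetti S (2 * 1),
      cupProduct (rfl : 2 * 1 + 2 * 1 = 2 * 2) a b = k3Form (η a) (η b) • p)
    (hrank : Module.finrank ℚ ↥(transcendentalCoords S η) ≤ 5) :
    HodgeTheory.IsKSCorrespondenceAlgebraicBetti hS.isSmoothProjective := by
  obtain ⟨m, hm, ι, hiso, hinj⟩ :=
    exists_transcendental_u3m_embedding_of_finrank_le_five hSig hS η p hp hpi hgen hint hcup hrank
  exact hF₁ S hS η p hp hpi hgen hint hcup m hm ι hiso hinj

/-- **K3 surfaces with `ρ ≥ 17`, powers half, in a marking**: for a K3 surface `S` with a Huybrechts marking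
`(η, p)` and `dim_ℚ H²_tr(S, ℚ) ≤ 5`, the Hodge conjecture holds for every power `Sᵏ` — Floccari 2026 Thm. 5.11
(ii) BY NAME (`hF₂`), the signature fact BY NAME (`hSig`), and `diagEmbedsU3m`. [cite: Floccari2026, Thm. 5.11 (ii) (§5)]
[cite: Huybrechts2016K3, Ch. 1 Prop. 2.4 and Ch. 3 Lemma 3.1] -/
theorem IsK3Surface.hodgeConjectureFor_pow_of_finrank_transcendentalCoords_le_five
    (hF₂ : Floccari2026_hodgeClasses_algebraic_powers_of_K3_of_transcendental_embedding)
    (hSig : Huybrechts2016_K3_transcendentalLattice_signature)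
    {S : Motives.SchemeOver ℂ} (hS : IsK3Surface S)
    (η : HodgeTheory.complexBetti S (2 * 1) ≃ₗ[ℂ] (K3Index → ℂ)) (p : HodgeTheory.complexBetti S (2 * 2))
    (hp : p ≠ 0) (hpi : HodgeTheory.IsIntegralClass p)
    (hgen : ∀ q : HodgeTheory.complexBetti S (2 * 2), HodgeTheory.IsIntegralClass q → ∃ n : ℤ, q = n • p)
    (hint : ∀ c : HodgeTheory.complexBetti S (2 * 1),
      HodgeTheory.IsIntegralClass c ↔ ∃ v : K3Index → ℤ, η c = fun i => (v i : ℂ))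
    (hcup : ∀ a b : HodgeTheory.complexBetti S (2 * 1),
      cupProduct (rfl : 2 * 1 + 2 * 1 = 2 * 2) a b = k3Form (η a) (η b) • p)
    (hrank : Module.finrank ℚ ↥(transcendentalCoords S η) ≤ 5) (k : ℕ) :
    HodgeTheory.HodgeConjectureFor (k * 2) (Motives.SchemeOver.pow S k) := by
  obtain ⟨m, hm, ι, hiso, hinj⟩ :=
    exists_transcendental_u3m_embedding_of_finrank_le_five hSig hS η p hp hpi hgen hint hcup hrank
  exact hF₂ S hS η p hp hpi hgen hint hcup m hm ι hiso hinj k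

/-! ### §4 THEOREM A, marking-free -/

/-- **THEOREM (K3 surfaces of Picard number `ρ ≥ 17`: algebraic Kuga–Satake correspondence).** For every complex
projective K3 surface `S` with `dim_ℂ (T(S) ⊗ ℂ) ≤ 5` — `T(S) ⊗ ℂ = NS(S)^⊥ ⊗ ℂ = transcendentalSubspace S`, of
dimension `22 − ρ(S)`, so the hypothesis reads `ρ(S) ≥ 17` — the Kuga–Satake correspondence of `S` is algebraic;
from Floccari 2026 Thm. 5.11 (i) (`hF₁`), the signature `(2, 20 − ρ)` of `T(S)` (`hSig`), the existence of a
marking (`hmark`), all BY NAME, and the tree theorem `diagEmbedsU3m`. [cite: Floccari2026, Thm. 5.11 (i) (§5)]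
[cite: Huybrechts2016K3, Ch. 1 Prop. 2.4 and Prop. 3.5, Ch. 3 Lemma 3.1, Ch. 4 §4] -/
theorem IsK3Surface.isKSCorrespondenceAlgebraicBetti_of_finrank_transcendental_le_five
    (hmark : Huybrechts_K3_marking_exists) (hSig : Huybrechts2016_K3_transcendentalLattice_signature)
    (hF₁ : Floccari2026_kugaSatakeCorrespondence_algebraic_of_K3_of_transcendental_embedding)
    {S : Motives.SchemeOver ℂ} (hS : IsK3Surface S) (hρ : Module.finrank ℂ ↥(transcendentalSubspace S) ≤ 5) :
    HodgeTheory.IsKSCorrespondenceAlgebraicBetti hS.isSmoothProjective := by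
  obtain ⟨η, p, x, hp, ⟨hpi, hgen, hint, hcup, -, -⟩, -⟩ := hmark S hS
  have hq := (hSig.finrank_transcendentalCoords_eq hS η p hp hpi hgen hint hcup).1
  exact hS.isKSCorrespondenceAlgebraicBetti_of_finrank_transcendentalCoords_le_five hF₁ hSig η p hp hpi hgen hint
    hcup (hq ▸ hρ)

/-- **THEOREM (K3 surfaces of Picard number `ρ ≥ 17`: the Hodge conjecture for all powers).** For every complex
projective K3 surface `S` with `dim_ℂ (T(S) ⊗ ℂ) ≤ 5` (i.e. `ρ(S) ≥ 17`) and every `k`, the Hodge conjecture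
holds for `Sᵏ` (all Hodge classes of all degrees on `Sᵏ` are algebraic); from Floccari 2026 Thm. 5.11 (ii)
(`hF₂`), the signature of `T(S)` (`hSig`) and the existence of a marking (`hmark`), BY NAME, and `diagEmbedsU3m`.
[cite: Floccari2026, Thm. 5.11 (ii) (§5)] [cite: Huybrechts2016K3, Ch. 1 Prop. 2.4 and Prop. 3.5, Ch. 3 Lemma 3.1] -/
theorem IsK3Surface.hodgeConjectureFor_pow_of_finrank_transcendental_le_five
    (hmark : Huybrechts_K3_marking_exists) (hSig : Huybrechts2016_K3_transcendentalLattice_signature)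
    (hF₂ : Floccari2026_hodgeClasses_algebraic_powers_of_K3_of_transcendental_embedding)
    {S : Motives.SchemeOver ℂ} (hS : IsK3Surface S) (hρ : Module.finrank ℂ ↥(transcendentalSubspace S) ≤ 5)
    (k : ℕ) : HodgeTheory.HodgeConjectureFor (k * 2) (Motives.SchemeOver.pow S k) := by
  obtain ⟨η, p, x, hp, ⟨hpi, hgen, hint, hcup, -, -⟩, -⟩ := hmark S hS
  have hq := (hSig.finrank_transcendentalCoords_eq hS η p hp hpi hgen hint hcup).1
  exact hS.hodgeConjectureFor_pow_of_finrank_transcendentalCoords_le_five hF₂ hSig η p hp hpi hgen hint hcup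
    (hq ▸ hρ) k

end Literature.AlgebraicGeometry.Surfaces

end
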